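import Summits.QuantumFields.BalabanUV.T4Continuum.Support.NE7PairDecompNL0
import Summits.QuantumFields.BalabanUV.T4Continuum.Support.NE7PairResidualSupRepGeneric
import HarnessLib

/-!
# NE7PairDecompNL0Generic — PORT MAP P3.0a: THE SLICE DECOMPOSITION OF AN ARBITRARY ADMISSIBLE PAIR AT `d = 4`, ANY BLOCK SIZE `L ≥ 2`, ANY `U(n)` — gen 105's
# `NE7PairDecompNL0.decomp_of_nl0_pair` (`L = 2`) RE-ISSUED GENERICALLY: for `0 < ε ≤ ε₂` with `10²¹·L⁶·card n·ε ≤ 1`, every `N ≥ 1`, datum `D`, level `k+1` (`M = L^{k+1}`) and admissible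
# `U♯, U′` over `D`: a unitary `(N·M)`-periodic gauge `u`, `U′^{u} = U♯·e^{X}`, `sup‖X‖·M ≤ C_S·ε`, `X = X_T + X_N`, `X_T ∈ 𝒯_E(U♯)`, `‖framePotW L (k+1) U♯ X_T z‖ ≤ frameC 4 L·C_S·ε`,
# the weighted letters `‖X_N‖_w ≤ ν‖X‖_w`, `(ε∕M²)Σ‖curl U♯ X_N‖ ≤ κ‖X‖_w²`, `ν ≤ ν_c·ε`, `κ ≤ κ_c·ε` — the near-representative supplied by P2.5b `pair_residual_sup_rep_generic`

Cell `pub-balaban`, rung (B)+1 sub-cell t4, lineage `b2b-balaban-t4-ne7-p1`, generation 109 (CRUX PROVER NE7 #1 = OWNER of BINDER row NE7).  Memo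
`t4/b2b-balaban-t4-ne7-p1-g109/ROAD-G109.md` §3 (PORT MAP item P3.0a; consumers: the generic re-issues of T-E_w♯ at block size `L`, (8)∀, uniqueness, (Gᶜ_w)).  Proof = gen 105's composition
verbatim under the recipe (letters `K₁, q₁, C_Θ` at block size `L` as in P2.6a).
WHAT ([folklore]; 0 def, 0 sorry).  **`decomp_of_nl0_pair_generic`**.
HONEST FRAMING (page 1): composition of landed kernel theorems of this lineage and of [B7]∕[B8] AS TYPED in the tree; nothing of Bałaban's asserted as an axiom; NOT T-E_w♯, NOT NE3, NOT NE7;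
spine count unchanged; finite T⁴ rung (B)+1 — NOT infinite volume, NOT mass gap, NOT BetaPertH, NOT Clay (continuum YM on T⁴ ⇐ BetaPertH ∧ nine spine estimates).
-/

set_option autoImplicit false

open scoped BigOperators Matrix Matrix.Norms.L2Operator
open NormedSpace Finset Set

namespace Summit.QuantumFields.BalabanUV.T4Continuum.NE7PairDecompNL0Generic

open Literature.MathematicalPhysics.QuantumFieldTheory.Balaban1983to89
open B7Prop1Explicit B7Prop2Explicit B7Prop3Flat MatrixLog
open B7Eq92Concrete (vcov)
open T4AveragingDeficitWall (IsUnitaryCfg IsSkewDir SmallField vary curl curlSq dirSq dirL1)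
open T4AveragingDeficitWallBoundary (IsPeriodicCfg periodBox)
open AveragingDeficitPeriodicCounting (IsPeriodicDir)
open AveragingDeficitTwoLevelPrep (prop1Radius)
open AveragingDeficitMultiLevelPrep (LevelSmall tower TangentIter cavgIter)
open AveragingDeficitMultiLevelBridge (cavgIter_eq_avgIter)
open MinimalActionLevels (perWin)
open MinimalActionSandwich (admissible)
open MinimalActionRate (sfClass)
open ReplicationRightInverseBound (radSum)
open BlockAverageVaryHolo (nbRad)
open NE3HessForm (dAction)
open NE3EnergyShapes (IsUnitarySite IsPeriodicSite)
open NE3EnergyWeightedShapes (energyNormW energyNormW_nonneg)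
open NE3QbarIterCovLiftPrep (cruxC liftC liftC_nonneg)
open NE3RightInverseSupLetters (frameC)
open NE3RightInverseSolveLetters (thetaLoc thetaLoc_nonneg l1Ball)
open NE3FrameGenLocal (frameRad)
open NE3RightInverseL2Letter (l2C l2C_nonneg)
open NE3HatInvCurlLetters (curl2C curl1C curl2C_nonneg curl1C_nonneg)
open NE3CovariantLineSumsError (Csup)
open ShellMeasureAverageProp4General (C1cov C1cov_pos)
open NE3FramePotBoundW (tower_eq_pow_mul)
open NE3TangentCovariantTower (framePotW)
open NE3.PairLandauB8Avg (relPert)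
open NE7MeanZeroGaugeSliceW (energyBlockLandauW)
open SpreadLift (loopRad)
open NE7FrameFreeRightInverse (rightInvW0 frameC_nonneg)
open NE7FrameFreeRightInverseLetters (dirSq_rightInvW0_le curlSq_rightInvW0_le sum_norm_curl_rightInvW0_le)
open NE7RightInverseFrameLetters (sum_normSq_framePotW_rightInvW_le sum_norm_framePotW_rightInvW_le)
open NE7SliceIterationState (repLog cornerLog)
open NE7SliceIterationStateNL (coarseDatumNL)
open NE7SliceIterationStateFacts (repLog_skew repLog_periodic)
open NE7SliceRepresentativeNL0 (slice_representative_nl0)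
open NE7SliceDirectLettersNL0 (directLetter_L1_nl0 directLetter_L2_nl0)
open NE7DecompOfLettersGeneric (decomp_of_letters)

open NE7DecompOfLettersGenericFixed (decomp_of_letters_fixed)
open NE7PairResidualSupRepGeneric (pair_residual_sup_rep_generic)
open NE7FrameFreeRightInverse (framePotW_rightInvW0)
open NE7SliceFrameMatchingLimit (framePotW_sub)
open NE3RightInverseSupLetters (norm_framePotW_le_of_sup)

noncomputable section

variable {n : Type} [Fintype n] [DecidableEq n]

set_option maxHeartbeats 800000 in
/-- **THE SLICE DECOMPOSITION OF AN ARBITRARY ADMISSIBLE PAIR** (`d = 4`, ANY BLOCK SIZE `L ≥ 2`; statement in the file header): gen 104's `hdecomp♭` body for ANY admissible `U♯, U′` over a common datum,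
with the near-representative supplied, the gauge periodic and the slice part's accumulated frame bounded by `frameC·C_S·ε`. [folklore] -/
theorem decomp_of_nl0_pair_generic [Nonempty n] {L : ℕ} (hL : 2 ≤ L) :
    ∃ ε₂ : ℝ, 0 < ε₂ ∧ ∃ CS : ℝ, 0 < CS ∧ ∃ νc : ℝ, 0 ≤ νc ∧ ∃ κc : ℝ, 0 ≤ κc ∧ ∀ (N : ℕ) [NeZero N] (ε : ℝ), 0 < ε → ε ≤ ε₂ →
      1000000000000000000000 * (L : ℝ) ^ 6 * (Fintype.card n : ℝ) * ε ≤ 1 →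
      ∀ (D : Site 4 → Fin 4 → (Matrix n n ℂ)ˣ) (k : ℕ),
        ∀ Us ∈ admissible (sfClass 4 L N ε) L (k + 1) D, ∀ U' ∈ admissible (sfClass 4 L N ε) L (k + 1) D,
        ∃ (u : Site 4 → (Matrix n n ℂ)ˣ) (X XT XN : Site 4 → Fin 4 → Matrix n n ℂ) (α ν κ : ℝ),
          IsUnitarySite u ∧ IsPeriodicSite u ((N * L ^ (k + 1) : ℕ) : ℤ) ∧ IsSkewDir X ∧ IsPeriodicDir X ((N * L ^ (k + 1) : ℕ) : ℤ) ∧ 0 ≤ α ∧ (∀ x μ, ‖X x μ‖ ≤ α) ∧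
          gaugeAct u U' = vary Us X 1 ∧
          X = XT + XN ∧ XT ∈ energyBlockLandauW (d := 4) (n := n) L N (k + 1) Us ∧
          (∀ z : Site 4, ‖framePotW L (k + 1) Us XT z‖ ≤ frameC 4 L * (CS * ε)) ∧ IsSkewDir XN ∧ 0 ≤ ν ∧
          energyNormW L (k + 1) Us XN (periodBox (d := 4) (N * L ^ (k + 1)))
            ≤ ν * energyNormW L (k + 1) Us X (periodBox (d := 4) (N * L ^ (k + 1))) ∧
          ε / ((L : ℝ) ^ (k + 1)) ^ 2 * (∑ p ∈ perWin 4 (N * L ^ (k + 1)), ‖curl Us XN p‖)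
            ≤ κ * energyNormW L (k + 1) Us X (periodBox (d := 4) (N * L ^ (k + 1))) ^ 2 ∧
          α * (L : ℝ) ^ (k + 1) ≤ CS * ε ∧ ν ≤ νc * ε ∧ κ ≤ κc * ε := by
  haveI : NeZero L := ⟨by omega⟩
  have hL1 : 1 ≤ L := by omega
  have hL0 : (0 : ℝ) < L := by exact_mod_cast (show 0 < L by omega)
  obtain ⟨ε₂, hε₂, CS, hCS, α₀, hα₀, hα1, hα2, hrep⟩ := slice_representative_nl0 (n := n) (d := 3) (by norm_num) hL (bh := 10000000000000000000000000000000000) (by norm_num)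
  -- the k-free letters at `d = 4`, block size `L`
  obtain ⟨K₁, hK₁⟩ : ∃ K₁ : ℝ, K₁ = C1cov 4 * (L : ℝ) ^ 2 * Real.sqrt (((4 : ℕ) : ℝ) * (2 * (2 * (L : ℝ)) + 1) ^ 4) := ⟨_, rfl⟩
  have hK₁0 : 0 ≤ K₁ := by rw [hK₁]; have := C1cov_pos 4; positivity
  obtain ⟨q₁, hq₁⟩ : ∃ q₁ : ℝ, q₁ = 64 * (C1cov 4 * (L : ℝ) ^ 2 * (((4 : ℕ) : ℝ) * (2 * (2 * (L : ℝ)) + 1) ^ 4)) * ((L : ℝ) ^ 4 / (L : ℝ) ^ 2) := ⟨_, rfl⟩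
  have hq₁0 : 0 ≤ q₁ := by rw [hq₁]; have := C1cov_pos 4; positivity
  obtain ⟨CΘ₂, hCΘ₂⟩ : ∃ CΘ₂ : ℝ, CΘ₂ = (2 : ℝ) ^ 4 * ((frameC 4 L * liftC 4) ^ 2 * ((l1Ball (frameRad 4 L) : Finset (Site 4))).card) := ⟨_, rfl⟩
  have hCΘ₂0 : 0 ≤ CΘ₂ := by rw [hCΘ₂]; positivity
  obtain ⟨CΘ₁, hCΘ₁⟩ : ∃ CΘ₁ : ℝ, CΘ₁ = (2 : ℝ) ^ 4 * (frameC 4 L * liftC 4 * ((l1Ball (frameRad 4 L) : Finset (Site 4))).card) := ⟨_, rfl⟩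
  have hCΘ₁0 : 0 ≤ CΘ₁ := by rw [hCΘ₁]; have := liftC_nonneg 4; have := frameC_nonneg 4 L; positivity
  obtain ⟨P, hP⟩ : ∃ P : ℝ, P = (Fintype.card (T4AveragingDeficitWall.Plane 4) : ℝ) := ⟨_, rfl⟩
  have hP0 : 0 ≤ P := by rw [hP]; positivity
  have hl2 := l2C_nonneg 4 L
  have hc2 := curl2C_nonneg 4 L
  have hc1 := curl1C_nonneg 4 L
  -- the ceilings
  obtain ⟨A₁, hA₁⟩ : ∃ A₁ : ℝ, A₁ = 4 * (2 * l2C 4 L + 2 * (16 * ((4 : ℕ) : ℝ) ^ 3 * ((64 : ℝ) ^ 4) ^ 2 * CΘ₂)) := ⟨_, rfl⟩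
  obtain ⟨A₂, hA₂⟩ : ∃ A₂ : ℝ, A₂ = 4 * (2 * curl2C 4 L + 2 * (16 * P * ((64 : ℝ) ^ 4) ^ 2 * CΘ₂)) := ⟨_, rfl⟩
  obtain ⟨A₃, hA₃⟩ : ∃ A₃ : ℝ, A₃ = 2 * curl1C 4 L + 2 * (4 * P * (64 : ℝ) ^ 4 * CΘ₁) := ⟨_, rfl⟩
  have hA₁0 : 0 ≤ A₁ := by rw [hA₁]; positivity
  have hA₂0 : 0 ≤ A₂ := by rw [hA₂]; positivity
  have hA₃0 : 0 ≤ A₃ := by rw [hA₃]; positivity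
  refine ⟨ε₂, hε₂, CS, hCS, Real.sqrt (A₁ + A₂) * (32 * K₁ * CS), by positivity, A₃ * q₁, by positivity, ?_⟩
  intro N _ ε hε hεle hθline D k Us hUs U' hU'
  have hN : 1 ≤ N := Nat.one_le_iff_ne_zero.mpr (NeZero.ne N)
  -- gen 94's residual near-representative of the pair
  have hηpos : 0 < ε / ((L : ℝ) ^ (k + 1)) ^ 2 := by positivity
  have hθ' : 1000000000000000000000 * (L : ℝ) ^ 6 * (Fintype.card n : ℝ) * (((L : ℝ) ^ (k + 1)) ^ 2 * (ε / ((L : ℝ) ^ (k + 1)) ^ 2)) ≤ 1 := by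
    have hid : ((L : ℝ) ^ (k + 1)) ^ 2 * (ε / ((L : ℝ) ^ (k + 1)) ^ 2) = ε := by field_simp
    rw [hid]; exact hθline
  have hUs' : IsUnitaryCfg Us ∧ IsPeriodicCfg Us ((N * L ^ (k + 1) : ℕ) : ℤ) ∧ SmallField Us (ε / ((L : ℝ) ^ (k + 1)) ^ 2) := hUs.1
  have hU'' : IsUnitaryCfg U' ∧ IsPeriodicCfg U' ((N * L ^ (k + 1) : ℕ) : ℤ) ∧ SmallField U' (ε / ((L : ℝ) ^ (k + 1)) ^ 2) := hU'.1
  have htop₀ : cavgIter L (k + 1) U' = cavgIter L (k + 1) Us := by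
    rw [cavgIter_eq_avgIter, cavgIter_eq_avgIter, hU'.2, hUs.2]
  obtain ⟨u₀, hu₀, hu₀P, hpin, hclose⟩ :=
    pair_residual_sup_rep_generic hL hU''.1 hUs'.1 hN hU''.2.1 hUs'.2.1 hηpos hU''.2.2 hUs'.2.2 htop₀ hθ'
  -- the pair's class data
  have hT : (tower L N (k + 1) : ℕ) = N * L ^ (k + 1) := by rw [tower_eq_pow_mul, Nat.mul_comm]
  obtain ⟨⟨hWu, hWP, hWx⟩, hWavg⟩ := hUs
  obtain ⟨⟨hU'u, hU'P, hU'x⟩, hU'avg⟩ := hU'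
  have hWPt : IsPeriodicCfg Us ((tower L N (k + 1) : ℕ) : ℤ) := by rw [hT]; exact hWP
  have hU'Pt : IsPeriodicCfg U' ((tower L N (k + 1) : ℕ) : ℤ) := by rw [hT]; exact hU'P
  have htop : cavgIter L (k + 1) U' = cavgIter L (k + 1) Us := by rw [cavgIter_eq_avgIter, cavgIter_eq_avgIter, hU'avg, hWavg]
  have hu₀Pt : IsPeriodicSite u₀ ((tower L N (k + 1) : ℕ) : ℤ) := by rw [hT]; exact hu₀P
  have hpin' : ∀ z : Site 4, u₀ ((((L : ℕ) : ℤ)) ^ (k + 1) • z) = 1 := fun z => by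
    have h := hpin z; rwa [Nat.cast_pow] at h
  have hclose' : ∀ (x : Site 4) (μ : Fin 4), ‖(((Us x μ)⁻¹ * gaugeAct u₀ U' x μ : (Matrix n n ℂ)ˣ) : Matrix n n ℂ) - 1‖
      ≤ 10000000000000000000000000000000000 * (L : ℝ) ^ (k + 1) * (ε / ((L : ℝ) ^ (k + 1)) ^ 2) := hclose
  -- (S1)-NL0: the representative and the regime facts
  obtain ⟨hsk, hsk1, hθ, hθl, hθl2, hε1, hE, h52, hexpS, hc₃S, hsmS, hKS, hS1, hS4, u, hu, huP, hgauge, hXM, hcorner, hh, ⟨hφs, hφP⟩, hslice, hv0⟩ :=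
    hrep k N Us U' ε hε hεle hWu hWPt hWx hU'u hU'Pt hU'x hu₀ hu₀Pt hpin' hclose'
  -- sizes of the representative
  have hM0 : (0 : ℝ) < (L : ℝ) ^ (k + 1) := by positivity
  have hM1 : (1 : ℝ) ≤ (L : ℝ) ^ (k + 1) := one_le_pow₀ (by exact_mod_cast hL1)
  have hx : 0 ≤ ε / ((L : ℝ) ^ (k + 1)) ^ 2 := by positivity
  have hbS : 0 ≤ CS * ε / (L : ℝ) ^ (k + 1) := by positivity
  have hsup : ∀ (y : Site 4) (κ : Fin 4), ‖repLog Us U' u y κ‖ ≤ CS * ε / (L : ℝ) ^ (k + 1) := fun y κ => by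
    rw [le_div_iff₀ hM0, mul_comm]; exact hXM y κ
  have hX8 : ∀ (y : Site 4) (κ : Fin 4), ‖repLog Us U' u y κ‖ ≤ 1 / 8 := fun y κ =>
    (hsup y κ).trans ((div_le_self (by positivity) hM1).trans (by linarith only [hS4]))
  have hXs := repLog_skew hWu U' hU'u hu hgauge hX8
  have hXP : IsPeriodicDir (repLog Us U' u) ((N * L ^ (k + 1) : ℕ) : ℤ) := by rw [← hT]; exact repLog_periodic k N U' hWPt hU'Pt huP
  -- (S2)-NL0: the two direct letters at the representative
  have hDL1 := directLetter_L1_nl0 hL k hWu hWPt hx hsk hWx hα₀ hα1 hα2 h52 hbS hexpS hc₃S hsmS hKS U' hU'u hU'Pt hx hsk hU'x htop hu huP hgauge hX8 hsup hcorner hv0 hN hS1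
  have hDL2 := directLetter_L2_nl0 hL k hWu hWPt hx hsk hWx hα₀ hα1 hα2 h52 hbS hexpS hc₃S hsmS hKS U' hU'u hU'Pt hx hsk hU'x htop hu huP hgauge hX8 hsup hcorner hv0 hN
  -- the `R₀`-letters with row NE7b's frame masses
  have hΘ₂ := sum_normSq_framePotW_rightInvW_le hL k hWu hx hsk hWx N hθ hθl hWPt hφs
  have hΘ₁ := sum_norm_framePotW_rightInvW_le hL k hWu hx hsk hWx N hθ hθl hWPt hφs
  have hR1 := dirSq_rightInvW0_le hL k hWu hx hsk hWx N hθ hE hWPt hθl hε1 hφs (by norm_num) hΘ₂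
  have hR2 := curlSq_rightInvW0_le hL k hWu hx hsk hWx N hθ hE hWPt hθl hε1 hφs hΘ₂
  have hR3 := sum_norm_curl_rightInvW0_le hL k hWu hx hsk hWx N hθ hE hWPt hθl hε1 hφs hΘ₁
  -- the radius identity and `1/(1 − θ_loc ε) ≤ 2`
  have hid : ((L : ℝ) ^ (k + 1)) ^ 2 * (ε / ((L : ℝ) ^ (k + 1)) ^ 2) = ε := by field_simp
  rw [hid] at hθl hθl2 hε1 hΘ₂ hΘ₁ hR1 hR2 hR3
  have h1θ : 1 / 2 ≤ 1 - thetaLoc 4 L * ε := by linarith only [hθl2]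
  have hinv1 : 1 / (1 - thetaLoc 4 L * ε) ≤ 2 := by rw [div_le_iff₀ (by linarith only [h1θ])]; linarith only [h1θ]
  have hinv2 : 1 / (1 - thetaLoc 4 L * ε) ^ 2 ≤ 4 := by
    rw [div_le_iff₀ (by positivity)]; nlinarith only [h1θ]
  have hinv0 : 0 ≤ 1 / (1 - thetaLoc 4 L * ε) := by positivity
  -- constants of the three letters in the generic shape
  set M : ℝ := (L : ℝ) ^ (k + 1) with hM
  have hMne : M ≠ 0 := hM0.ne'
  set Dφ : ℝ := dirSq (coarseDatumNL L k Us U' u) (periodBox (d := 4) N) with hDφ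
  set Lφ : ℝ := dirL1 (coarseDatumNL L k Us U' u) (periodBox (d := 4) N) with hLφ
  have hDφ0 : 0 ≤ Dφ := by rw [hDφ]; unfold dirSq; positivity
  have hLφ0 : 0 ≤ Lφ := by rw [hLφ]; unfold dirL1; positivity
  set c₁ : ℝ := 2 * (l2C 4 L / (1 - thetaLoc 4 L * ε) ^ 2) + 2 * (16 * ((4 : ℕ) : ℝ) ^ 3 * ((64 : ℝ) ^ 4) ^ 2 * (CΘ₂ / (1 - thetaLoc 4 L * ε) ^ 2)) with hc₁
  set c₂ : ℝ := 2 * (curl2C 4 L / (1 - thetaLoc 4 L * ε) ^ 2) + 2 * (16 * P * ((64 : ℝ) ^ 4) ^ 2 * ε ^ 2 * (CΘ₂ / (1 - thetaLoc 4 L * ε) ^ 2)) with hc₂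
  set c₃ : ℝ := curl1C 4 L / (1 - thetaLoc 4 L * ε) + 4 * P * (64 : ℝ) ^ 4 * ε * (CΘ₁ / (1 - thetaLoc 4 L * ε)) with hc₃
  have hc₁0 : 0 ≤ c₁ := by positivity
  have hc₂0 : 0 ≤ c₂ := by positivity
  have hc₃0 : 0 ≤ c₃ := by positivity
  have hR1' : dirSq (rightInvW0 hL k hWu hx hsk hWx N hθ hE hφs) (periodBox (d := 4) (N * L ^ (k + 1))) ≤ c₁ * (M ^ 4 / M ^ 2) * Dφ := by
    refine hR1.trans (le_of_eq ?_)
    rw [hc₁, hCΘ₂]; ring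
  have hR2' : curlSq Us (rightInvW0 hL k hWu hx hsk hWx N hθ hE hφs) (periodBox (d := 4) (N * L ^ (k + 1))) ≤ c₂ * (M ^ 4 / M ^ 4) * Dφ := by
    refine hR2.trans (le_of_eq ?_)
    rw [hc₂, hCΘ₂, hP]; ring
  have hR3' : ∑ p ∈ perWin 4 (N * L ^ (k + 1)), ‖curl Us (rightInvW0 hL k hWu hx hsk hWx N hθ hE hφs) p‖ ≤ c₃ * (M ^ 4 / M ^ 2) * Lφ := by
    refine hR3.trans (le_of_eq ?_)
    rw [hc₃, hCΘ₁, hP]; ring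
  -- the direct letters in the generic shape
  set EX : ℝ := energyNormW L (k + 1) Us (repLog Us U' u) (periodBox (d := 4) (N * L ^ (k + 1))) with hEX
  have hq₂sq : 1024 * (C1cov 4 * (L : ℝ) ^ 2 * Real.sqrt (((4 : ℕ) : ℝ) * (2 * (2 * (L : ℝ)) + 1) ^ 4)) ^ 2 * ((L : ℝ) ^ 4 / (L : ℝ) ^ 4) * (M * (CS * ε / M)) ^ 2
      = (32 * K₁ * (CS * ε)) ^ 2 := by
    rw [hK₁]; field_simp; ring
  have hDL2' : M ^ 4 / M ^ 4 * Dφ ≤ (32 * K₁ * (CS * ε)) ^ 2 * EX ^ 2 := by rw [← hq₂sq]; exact hDL2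
  have hDL1' : M ^ 4 / M ^ 4 * Lφ ≤ q₁ * EX ^ 2 := by rw [hq₁]; exact hDL1
  -- the accumulated frame of the slice part: `framePotW (X − R₀φ̃) = framePotW X` (R₀ is frame-free), `≤ frameC·M·sup‖X‖ = frameC·C_S·ε`
  have hframe : ∀ (hφ : IsSkewDir (coarseDatumNL L k Us U' u)) (z : Site 4),
      ‖framePotW L (k + 1) Us (fun y μ => repLog Us U' u y μ - rightInvW0 hL k hWu hx hsk hWx N hθ hE hφ y μ) z‖ ≤ frameC 4 L * (CS * ε) := by
    intro hφ z
    rw [framePotW_sub hL k hWu hx hsk hWx, framePotW_rightInvW0 hL k hWu hx hsk hWx N hθ hE hφ hWPt 0 z, sub_zero]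
    refine (norm_framePotW_le_of_sup hL k hWu hx hsk hWx (repLog Us U' u) hbS hsup z).trans (le_of_eq ?_)
    rw [← hM]; field_simp
  -- the junction: the two weighted letters of the normal part `R₀φ̃`
  obtain ⟨hXdec, hXN, hν, hN1, hN2⟩ :=
    decomp_of_letters_fixed (d := 4) (L := L) (N := N) k hε (Us := Us)
      (fun j W => energyBlockLandauW (d := 4) (n := n) L N (j + 1) W) (fun Y hY => hY.1) (φ := coarseDatumNL L k Us U' u)
      (q₂ := 32 * K₁ * (CS * ε)) (q₁ := q₁) (c₁ := c₁) (c₂ := c₂) (c₃ := c₃) (by positivity) hc₁0 hc₂0 hc₃0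
      hXs (hslice hWu hx hsk hWx hθ hE hφs) hR1' hR2' hR3' hDL2' hDL1'
  have huP' : IsPeriodicSite u ((N * L ^ (k + 1) : ℕ) : ℤ) := by rw [← hT]; exact huP
  refine ⟨u, repLog Us U' u, _, _, CS * ε / (L : ℝ) ^ (k + 1), Real.sqrt (c₁ + c₂) * (32 * K₁ * (CS * ε)), ε * c₃ * q₁, hu, huP', hXs, hXP, hbS, hsup, hgauge,
    hXdec, hslice hWu hx hsk hWx hθ hE hφs, hframe hφs, hXN, hν, hN1, hN2, ?_, ?_, ?_⟩
  · rw [← hM]; exact le_of_eq (by field_simp)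
  · -- `ν = √(c₁+c₂)·32K₁C_Sε ≤ √(A₁+A₂)·32K₁C_S·ε`
    have hε1' : ε ^ 2 ≤ 1 := by nlinarith only [hε.le, hε1]
    have hc₁le : c₁ ≤ A₁ := by
      rw [hc₁, hA₁]
      have t1 : l2C 4 L / (1 - thetaLoc 4 L * ε) ^ 2 ≤ 4 * l2C 4 L := by
        rw [div_eq_mul_one_div]; nlinarith only [hinv2, hl2, mul_nonneg hl2 (show (0:ℝ) ≤ 1 / (1 - thetaLoc 4 L * ε) ^ 2 by positivity)]
      have t2 : CΘ₂ / (1 - thetaLoc 4 L * ε) ^ 2 ≤ 4 * CΘ₂ := by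
        rw [div_eq_mul_one_div]; nlinarith only [hinv2, hCΘ₂0, mul_nonneg hCΘ₂0 (show (0:ℝ) ≤ 1 / (1 - thetaLoc 4 L * ε) ^ 2 by positivity)]
      nlinarith only [t1, t2, hCΘ₂0]
    have hc₂le : c₂ ≤ A₂ := by
      rw [hc₂, hA₂]
      have t1 : curl2C 4 L / (1 - thetaLoc 4 L * ε) ^ 2 ≤ 4 * curl2C 4 L := by
        rw [div_eq_mul_one_div]; nlinarith only [hinv2, hc2, mul_nonneg hc2 (show (0:ℝ) ≤ 1 / (1 - thetaLoc 4 L * ε) ^ 2 by positivity)]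
      have t2 : CΘ₂ / (1 - thetaLoc 4 L * ε) ^ 2 ≤ 4 * CΘ₂ := by
        rw [div_eq_mul_one_div]; nlinarith only [hinv2, hCΘ₂0, mul_nonneg hCΘ₂0 (show (0:ℝ) ≤ 1 / (1 - thetaLoc 4 L * ε) ^ 2 by positivity)]
      have t3 : 16 * P * ((64 : ℝ) ^ 4) ^ 2 * ε ^ 2 * (CΘ₂ / (1 - thetaLoc 4 L * ε) ^ 2) ≤ 16 * P * ((64 : ℝ) ^ 4) ^ 2 * 1 * (4 * CΘ₂) := by
        have h0 : 0 ≤ CΘ₂ / (1 - thetaLoc 4 L * ε) ^ 2 := by positivity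
        calc _ ≤ 16 * P * ((64 : ℝ) ^ 4) ^ 2 * 1 * (CΘ₂ / (1 - thetaLoc 4 L * ε) ^ 2) := by gcongr
          _ ≤ _ := by gcongr
      nlinarith only [t1, t3]
    have hsq : Real.sqrt (c₁ + c₂) ≤ Real.sqrt (A₁ + A₂) := Real.sqrt_le_sqrt (by linarith only [hc₁le, hc₂le])
    have h0 : 0 ≤ 32 * K₁ * (CS * ε) := by positivity
    calc Real.sqrt (c₁ + c₂) * (32 * K₁ * (CS * ε)) ≤ Real.sqrt (A₁ + A₂) * (32 * K₁ * (CS * ε)) := mul_le_mul_of_nonneg_right hsq h0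
      _ = Real.sqrt (A₁ + A₂) * (32 * K₁ * CS) * ε := by ring
  · -- `κ = ε·c₃·q₁ ≤ (A₃ q₁)·ε`
    have hc₃le : c₃ ≤ A₃ := by
      rw [hc₃, hA₃]
      have t1 : curl1C 4 L / (1 - thetaLoc 4 L * ε) ≤ 2 * curl1C 4 L := by
        rw [div_eq_mul_one_div]; nlinarith only [hinv1, hc1, mul_nonneg hc1 hinv0]
      have t2 : CΘ₁ / (1 - thetaLoc 4 L * ε) ≤ 2 * CΘ₁ := by
        rw [div_eq_mul_one_div]; nlinarith only [hinv1, hCΘ₁0, mul_nonneg hCΘ₁0 hinv0]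
      have t3 : 4 * P * (64 : ℝ) ^ 4 * ε * (CΘ₁ / (1 - thetaLoc 4 L * ε)) ≤ 4 * P * (64 : ℝ) ^ 4 * 1 * (2 * CΘ₁) := by
        have h0 : 0 ≤ CΘ₁ / (1 - thetaLoc 4 L * ε) := by positivity
        calc _ ≤ 4 * P * (64 : ℝ) ^ 4 * 1 * (CΘ₁ / (1 - thetaLoc 4 L * ε)) := by gcongr
          _ ≤ _ := by gcongr
      nlinarith only [t1, t3]
    have h := mul_le_mul_of_nonneg_right hc₃le hq₁0
    calc ε * c₃ * q₁ = (c₃ * q₁) * ε := by ring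
      _ ≤ (A₃ * q₁) * ε := mul_le_mul_of_nonneg_right h hε.le



end

end Summit.QuantumFields.BalabanUV.T4Continuum.NE7PairDecompNL0Generic
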